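import Literature.IUT.LogVolume.HullModel
import Literature.IUT.LogVolume.PacketVolume
import Literature.IUT.LogThetaLattice.HolomorphicHull
import HarnessLib

/-!
# [IUTchIII] Remark 3.9.5 (iv) (Ξ3) at GENERAL cardinality, in the model: for `|J| ≥ 2` there is a direct
# product region `P` with `μ^{log}(P) < μ^{log}(H_Ξ(P))`

Mochizuki, [IUTchIII] Rmk. 3.9.5 (iv) (Ξ3), kurims p. 129 l.8–11 (read on the page): "(Ξ3) in the situation of
(Ξ1), if `(𝕍_mod)_{v_ℚ}` [cf. the notational conventions of Remark 3.1.1, (iii)] and `A` are of cardinality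
`≥ 2`, then one verifies easily that there exist `P ∈ Preg` for which `μ^{log}(P) < μ^{log}(H_Ξ(P))
(≤ μ^{log}(H_Φ(P)) = μ^{log}(φ(P)))`", followed by the printed EXAMPLE `I = ℚ_p × ℚ_p`, `H₀ = ℤ_p × ℤ_p`,
`H₁ = (p^{-1}ℤ_p) × (pℤ_p)`, `P = H₀ ∪ ({p^{-1}} × ℤ_p)`, "`μ_I(P) = μ_I(H₀) = 1 < 2 − p^{-1} = μ_I(H₀ ∪ H₁)`"
(computed in the model by abc-iut-S2, `Xi3Model.lean`, at `I = K × K`).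

THIS proof-only file proves the GENERAL-CARDINALITY existence claim in the same model (campaign-S
`HullModel.lean`: a finite family `K_j`, `j ∈ J`, of nonarchimedean local fields, hull-sets `λ·𝒪_L`
(`hullSets K`), the constructed holomorphic hull `holomorphicHull K`, the product volume `piVolume K`
normalised by `μ(𝒪_L) = 1` — print's `μ_I` — and `μ^{log} := log ∘ μ` on subsets; `H_Ξ(P)` is the layer-L6
typing `LogThetaLattice.HXi Hul φ μ^{log} P := ⋃ Ξ(P)`, abc-iut-L6-t4 `HolomorphicHull.lean`):

* `exists_region_logVol_lt_logVol_hXi` — for ANY two distinct indices `j₀ ≠ j₁`, uniformizers `ϖ₀, ϖ₁` and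
  exponents `a, b ≥ 1` with `q_{j₀}^a = q_{j₁}^b` (always available inside one `v_ℚ`: `q_j = p^{f_j}`, take
  `a = f_{j₁}`, `b = f_{j₀}`), the direct product region `P := (𝒪_{j₀} ∪ {ϖ₀^{-a}}) × Π_{j ≠ j₀} 𝒪_j` has
  `μ(P) = 1`, the two hull-sets `H₀ := Π_j 𝒪_j` and `H₁ := ϖ₀^{-a}𝒪_{j₀} × ϖ₁^{b}𝒪_{j₁} × Π 𝒪_j` lie in
  `Ξ(P)` (both `⊆ φ(P)`, both of volume `1 = μ(P)`), and `μ(H_Ξ(P)) ≥ μ(H₀ ∪ H₁) ≥ 2 − q_{j₁}^{-b} > 1`, whence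
  `μ^{log}(P) = 0 < μ^{log}(H_Ξ(P))`;
* `exists_region_logVol_lt_logVol_hXi_of_residueCard_eq` — the equal-residue-field case (`a = b = 1`; print's
  example is `K_{j₀} = K_{j₁} = ℚ_p`).
[cite: Mochizuki2012, IUTchIII Rmk. 3.9.5 (iv) p. 129] [cite: MochizukiAbsTopIII2015, Prop. 5.7 (i)(a) p. 137]
HONEST SCOPE: equal weights (the product Haar measure `μ_I`, as in the printed example); for UNEQUAL
Rmk 3.1.1 (ii) weights `μ^{log}` is not the logarithm of a measure on non-product sets (abc-iut-L6-t4
`Remark311iii_weightedSum_not_log_measure`), so `μ^{log}(H_Ξ(P))` has no printed meaning there — cf. the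
cell's E-13 register entry on (Ξ1^non). Nothing here bears on [IUTchIII] Cor. 3.12 (Rmk. 3.9.5 (iv) lies
outside its cone) or takes a side. No definitions.
-/

noncomputable section

open MeasureTheory Set Metric TopologicalSpace Bornology
open scoped ENNReal NNReal Pointwise NormedField
open Literature.NumberTheory.GaloisRepresentations.Ultrametric

namespace Literature.IUT.LogVolume

namespace Xi3General

variable {J : Type*} [Fintype J] (K : J → Type*) [∀ j, NontriviallyNormedField (K j)]
  [∀ j, IsUltrametricDist (K j)] [∀ j, ProperSpace (K j)] [∀ j, MeasurableSpace (K j)]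
  [∀ j, BorelSpace (K j)]

/-- Volumes of polydiscs are finite (bounded sets in the proper space `⊕_j K_j`).
[cite: MochizukiAbsTopIII2015, Prop. 5.7 (i)(a) p. 137] -/
theorem piVolume_polydisc_ne_top (r : J → ℝ) : piVolume K (polydisc K r) ≠ ∞ := by
  haveI : Measure.IsAddHaarMeasure (piVolume K) := by unfold piVolume; infer_instance
  exact ((isBounded_polydisc K r).isCompact_closure.measure_lt_top.trans_le'
    (measure_mono subset_closure)).ne

/-- The real volume of a polydisc is the product of the factor volumes.
[cite: Mochizuki2012, IUTchIII Rmk. 3.1.1 (iii) p. 95] -/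
theorem piVolume_real_polydisc (r : J → ℝ) :
    (piVolume K (polydisc K r)).toReal = ∏ j, (localVolume (K j) (closedBall (0 : K j) (r j))).toReal := by
  rw [piVolume_polydisc, ENNReal.toReal_prod]

/-- **IUTchIII:Rmk3.9.5(iv) (Ξ3), general cardinality, IN THE MODEL.**  For two distinct indices `j₀ ≠ j₁`,
uniformizers `ϖ₀ ∈ K_{j₀}`, `ϖ₁ ∈ K_{j₁}` and exponents with `q_{j₀}^a = q_{j₁}^b`, `b ≥ 1`, there is a direct
product region `P` (namely `(𝒪 ∪ {ϖ₀^{-a}}) × Π_{j≠j₀} 𝒪`) with `μ^{log}(P) < μ^{log}(H_Ξ(P))` for `μ^{log} = log ∘ μ_I`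
and L6's `H_Ξ` over the hull-sets and the constructed holomorphic hull — PROVED.
[cite: Mochizuki2012, IUTchIII Rmk. 3.9.5 (iv) p. 129] -/
theorem exists_region_logVol_lt_logVol_hXi {j₀ j₁ : J} (hne : j₀ ≠ j₁) {ϖ₀ : (K j₀)ˣ} {ϖ₁ : (K j₁)ˣ}
    (hϖ₀ : IsUniformizer ϖ₀) (hϖ₁ : IsUniformizer ϖ₁) {a b : ℕ} (hb : 0 < b)
    (hab : (residueCard (K j₀) : ℝ) ^ a = (residueCard (K j₁) : ℝ) ^ b) :
    ∃ P ∈ directProductRegions K,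
      Real.log (piVolume K P).toReal <
        Real.log (piVolume K (LogThetaLattice.HXi (hullSets K) (holomorphicHull K)
          (fun S => Real.log (piVolume K S).toReal) P)).toReal := by
  classical
  haveI : Measure.IsAddHaarMeasure (piVolume K) := by unfold piVolume; infer_instance
  -- basic constants
  have hq₀ : (1 : ℝ) < residueCard (K j₀) := one_lt_residueCard_real (K j₀)
  have hq₁ : (1 : ℝ) < residueCard (K j₁) := one_lt_residueCard_real (K j₁)
  have hϖ₀pos : 0 < ‖(ϖ₀ : K j₀)‖ := norm_pos_iff.mpr ϖ₀.ne_zero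
  have hϖ₁le : ‖(ϖ₁ : K j₁)‖ ≤ 1 := hϖ₁.1.le
  -- the distinguished elements `x₀ = ϖ₀^{-a} ∈ K_{j₀}` and `y₁ = ϖ₁^b ∈ K_{j₁}`
  set x₀ : K j₀ := (((ϖ₀ ^ (-(a : ℤ))) : (K j₀)ˣ) : K j₀) with hx₀
  set y₁ : K j₁ := (ϖ₁ : K j₁) ^ b with hy₁
  have hx₀norm : ‖x₀‖ = ‖(ϖ₀ : K j₀)‖ ^ (-(a : ℤ)) := by
    rw [hx₀, Units.val_zpow_eq_zpow_val, norm_zpow]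
  have hx₀ge : 1 ≤ ‖x₀‖ := by
    rw [hx₀norm, zpow_neg, zpow_natCast, ← inv_pow]
    exact one_le_pow₀ (one_le_inv_iff₀.mpr ⟨hϖ₀pos, hϖ₀.1.le⟩)
  have hx₀ne : x₀ ≠ 0 := norm_pos_iff.mp (lt_of_lt_of_le one_pos hx₀ge)
  have hy₁norm : ‖y₁‖ = ‖(ϖ₁ : K j₁)‖ ^ (b : ℤ) := by rw [hy₁, norm_pow, zpow_natCast]
  have hy₁le : ‖y₁‖ ≤ 1 := by rw [hy₁, norm_pow]; exact pow_le_one₀ (norm_nonneg _) hϖ₁le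
  have hy₁ne : y₁ ≠ 0 := by rw [hy₁]; exact pow_ne_zero _ ϖ₁.ne_zero
  -- the region `P = (𝒪 ∪ {x₀}) × Π 𝒪` and the base points `𝟙 ∈ P`, `u = (x₀ at j₀, 1 elsewhere) ∈ P`
  set A : ∀ j, Set (K j) := Function.update (fun j => closedBall (0 : K j) 1) j₀ (closedBall 0 1 ∪ {x₀})
    with hA
  have hAj₀ : A j₀ = closedBall 0 1 ∪ {x₀} := by rw [hA, Function.update_self]
  have hAj : ∀ j, j ≠ j₀ → A j = closedBall 0 1 := fun j hj => by rw [hA, Function.update_of_ne hj]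
  have hball : ∀ j, closedBall (0 : K j) 1 ⊆ A j := fun j => by
    by_cases hj : j = j₀
    · subst hj; rw [hAj₀]; exact subset_union_left
    · rw [hAj j hj]
  set P : Set (Π j, K j) := Set.pi univ A with hP
  have h1P : (fun j => (1 : K j)) ∈ P := fun j _ => hball j (by simp)
  set u : Π j, K j := Function.update (fun j => (1 : K j)) j₀ x₀ with hu
  have huP : u ∈ P := fun j _ => by
    by_cases hj : j = j₀
    · subst hj; rw [hu, Function.update_self, hAj₀]; exact Or.inr rfl
    · rw [hu, Function.update_of_ne hj]; exact hball j (by simp)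
  -- `P` is bounded: `P ⊆` the polydisc of radii `(‖x₀‖ at j₀, 1 elsewhere)`
  have hPsub : P ⊆ polydisc K (fun j => if j = j₀ then ‖x₀‖ else 1) := by
    intro x hx
    rw [mem_polydisc]
    intro j
    have hxj : x j ∈ A j := hx j (mem_univ j)
    by_cases hj : j = j₀
    · subst hj
      rw [if_pos rfl]
      rw [hAj₀] at hxj
      rcases hxj with h | h
      · exact (mem_closedBall_zero_iff.mp h).trans hx₀ge
      · rw [mem_singleton_iff.mp h]
    · rw [if_neg hj, hAj j hj] at *
      exact mem_closedBall_zero_iff.mp hxj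
  have hPbdd : IsBounded P := (isBounded_polydisc K _).subset hPsub
  -- the hull-sets `H₀ = Π 𝒪` and `H₁ = x₀𝒪 × y₁𝒪 × Π 𝒪`
  set c₁ : Π j, K j := Function.update (Function.update (fun j => (1 : K j)) j₁ y₁) j₀ x₀ with hc₁
  have hc₁j₀ : c₁ j₀ = x₀ := by rw [hc₁, Function.update_self]
  have hc₁j₁ : c₁ j₁ = y₁ := by
    rw [hc₁, Function.update_of_ne hne.symm, Function.update_self]
  have hc₁j : ∀ j, j ≠ j₀ → j ≠ j₁ → c₁ j = 1 := fun j h0 h1 => by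
    rw [hc₁, Function.update_of_ne h0, Function.update_of_ne h1]
  have hc₁ne : ∀ j, c₁ j ≠ 0 := fun j => by
    by_cases h0 : j = j₀
    · subst h0; rw [hc₁j₀]; exact hx₀ne
    by_cases h1 : j = j₁
    · subst h1; rw [hc₁j₁]; exact hy₁ne
    · rw [hc₁j j h0 h1]; exact one_ne_zero
  set H₀ : Set (Π j, K j) := polydisc K (fun _ => 1) with hH₀
  set H₁ : Set (Π j, K j) := hullSet K c₁ with hH₁
  have hH₀hul : H₀ ∈ hullSets K := by
    refine ⟨fun j => (1 : K j), fun j => one_ne_zero, ?_⟩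
    rw [hH₀]; unfold hullSet; simp
  have hH₁hul : H₁ ∈ hullSets K := ⟨c₁, hc₁ne, rfl⟩
  -- `H₀ ⊆ P ⊆ φ(P)` and `H₁ ⊆ φ(P)` (the radii of `H₁` are attained in `P`)
  have hH₀P : H₀ ⊆ P := fun x hx j _ => hball j (mem_closedBall_zero_iff.mpr ((mem_polydisc K).mp hx j))
  have hφ : holomorphicHull K P = polydisc K (hullRadius K P) := holomorphicHull_of_isBounded K hPbdd
  have hH₀φ : H₀ ⊆ holomorphicHull K P := hH₀P.trans (subset_holomorphicHull K P)
  have hH₁φ : H₁ ⊆ holomorphicHull K P := by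
    rw [hφ, hH₁]
    refine polydisc_mono K fun j => ?_
    by_cases h0 : j = j₀
    · subst h0
      rw [hc₁j₀, show ‖x₀‖ = ‖u j‖ by rw [hu, Function.update_self]]
      exact norm_apply_le_hullRadius K hPbdd huP j
    · have h1le : ‖c₁ j‖ ≤ ‖(fun i => (1 : K i)) j‖ := by
        by_cases h1 : j = j₁
        · subst h1; rw [hc₁j₁]; simpa using hy₁le
        · rw [hc₁j j h0 h1]
      exact h1le.trans (norm_apply_le_hullRadius K hPbdd h1P j)
  -- volumes: `μ(H₀) = 1`, `μ(H₁) = q₀^a · q₁^{-b} = 1`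
  have hvolH₀ : (piVolume K H₀).toReal = 1 := by rw [hH₀, piVolume_unitPolydisc, ENNReal.toReal_one]
  have hvolH₁ : (piVolume K H₁).toReal = 1 := by
    rw [hH₁, show hullSet K c₁ = polydisc K (fun j => ‖c₁ j‖) from rfl, piVolume_real_polydisc]
    rw [Finset.prod_eq_mul j₀ j₁ hne (fun j _ hj => by
        rw [hc₁j j hj.1 hj.2, norm_one, localVolume_closedBall_one, ENNReal.toReal_one])
      (fun h => absurd (Finset.mem_univ _) h) (fun h => absurd (Finset.mem_univ _) h)]
    rw [hc₁j₀, hc₁j₁, hx₀norm, hy₁norm, localVolume_real_closedBall_zpow (K j₀) hϖ₀,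
      localVolume_real_closedBall_zpow (K j₁) hϖ₁, neg_neg, zpow_natCast, zpow_neg, zpow_natCast, hab,
      mul_inv_cancel₀ (pow_ne_zero _ (by linarith))]
  -- `μ(P) = 1`: `H₀ ⊆ P ⊆ H₀ ∪ (slice {x₀} × Π 𝒪)`, the slice being null
  have hvolP : (piVolume K P).toReal = 1 := by
    set Sl : Set (Π j, K j) :=
      Set.pi univ (Function.update (fun j => closedBall (0 : K j) 1) j₀ ({x₀} : Set (K j₀))) with hSl
    have hPsub' : P ⊆ H₀ ∪ Sl := by
      intro x hx
      have hxj : ∀ j, x j ∈ A j := fun j => hx j (mem_univ j)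
      by_cases hcase : x j₀ ∈ closedBall (0 : K j₀) 1
      · left
        rw [hH₀, mem_polydisc]
        intro j
        by_cases hj : j = j₀
        · subst hj; exact mem_closedBall_zero_iff.mp hcase
        · exact mem_closedBall_zero_iff.mp (by simpa [hAj j hj] using hxj j)
      · right
        intro j _
        by_cases hj : j = j₀
        · subst hj
          rw [Function.update_self]
          have := hxj j
          rw [hAj₀] at this
          exact this.resolve_left hcase
        · rw [Function.update_of_ne hj]
          simpa [hAj j hj] using hxj j
    have hSl0 : piVolume K Sl = 0 := by
      rw [hSl, piVolume_eq_pi, Measure.pi_pi]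
      apply Finset.prod_eq_zero (Finset.mem_univ j₀)
      rw [Function.update_self, show ({x₀} : Set (K j₀)) = x₀ +ᵥ ({0} : Set (K j₀)) by simp,
        localVolume_vadd]
      exact localVolume_singleton_zero K j₀
    have hle : piVolume K P ≤ piVolume K H₀ :=
      calc piVolume K P ≤ piVolume K (H₀ ∪ Sl) := measure_mono hPsub'
        _ ≤ piVolume K H₀ + piVolume K Sl := measure_union_le _ _
        _ = piVolume K H₀ := by rw [hSl0, add_zero]
    have hge : piVolume K H₀ ≤ piVolume K P := measure_mono hH₀P
    rw [le_antisymm hle hge, hvolH₀]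
  -- `H₀, H₁ ∈ Ξ(P)` hence `H₀ ∪ H₁ ⊆ H_Ξ(P) ⊆ φ(P)`
  set μlog : Set (Π j, K j) → ℝ := fun S => Real.log (piVolume K S).toReal with hμlog
  have hΞ₀ : H₀ ∈ LogThetaLattice.XiApprox (hullSets K) (holomorphicHull K) μlog P :=
    ⟨hH₀hul, hH₀φ, by simp only [hμlog, hvolH₀, hvolP]⟩
  have hΞ₁ : H₁ ∈ LogThetaLattice.XiApprox (hullSets K) (holomorphicHull K) μlog P :=
    ⟨hH₁hul, hH₁φ, by simp only [hμlog, hvolH₁, hvolP]⟩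
  have hUsub : H₀ ∪ H₁ ⊆ LogThetaLattice.HXi (hullSets K) (holomorphicHull K) μlog P :=
    union_subset (subset_sUnion_of_mem hΞ₀) (subset_sUnion_of_mem hΞ₁)
  have hΞφ : LogThetaLattice.HXi (hullSets K) (holomorphicHull K) μlog P ⊆ holomorphicHull K P :=
    (LogThetaLattice.hXi_subset_hPhi_subset (hullSets K) (holomorphicHull K) μlog P).1.trans
      (LogThetaLattice.hXi_subset_hPhi_subset (hullSets K) (holomorphicHull K) μlog P).2
  have hΞfin : piVolume K (LogThetaLattice.HXi (hullSets K) (holomorphicHull K) μlog P) ≠ ∞ := by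
    refine (lt_of_le_of_lt (measure_mono hΞφ) ?_).ne
    rw [hφ]
    exact (piVolume_polydisc_ne_top K _).lt_top
  -- `μ(H₀ ∪ H₁) ≥ 2 − q₁^{-b} > 1` by inclusion–exclusion, `H₀ ∩ H₁ ⊆ 𝒪 × y₁𝒪 × Π 𝒪`
  have hmeas₁ : MeasurableSet H₁ := by
    rw [hH₁]; unfold hullSet polydisc
    exact MeasurableSet.univ_pi fun j => measurableSet_closedBall
  have hfin₀ : piVolume K H₀ ≠ ∞ := by rw [hH₀]; exact piVolume_polydisc_ne_top K _
  have hfin₁ : piVolume K H₁ ≠ ∞ := by rw [hH₁]; exact piVolume_polydisc_ne_top K _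
  have hie := measure_union_add_inter (μ := piVolume K) H₀ hmeas₁
  have hfinU : piVolume K (H₀ ∪ H₁) ≠ ∞ := (measure_union_lt_top hfin₀.lt_top hfin₁.lt_top).ne
  have hfinI : piVolume K (H₀ ∩ H₁) ≠ ∞ :=
    (lt_of_le_of_lt (measure_mono inter_subset_left) hfin₀.lt_top).ne
  have hreal : (piVolume K (H₀ ∪ H₁)).toReal + (piVolume K (H₀ ∩ H₁)).toReal = 1 + 1 := by
    have := congrArg ENNReal.toReal hie
    rwa [ENNReal.toReal_add hfinU hfinI, ENNReal.toReal_add hfin₀ hfin₁, hvolH₀, hvolH₁] at this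
  set Rm : J → ℝ := fun j => if j = j₁ then ‖y₁‖ else 1 with hRm
  have hIsub : H₀ ∩ H₁ ⊆ polydisc K Rm := by
    rintro x ⟨hx0, hx1⟩
    rw [mem_polydisc]
    intro j
    by_cases h1 : j = j₁
    · subst h1
      rw [hRm]; simp only [if_true]
      have := (mem_polydisc K).mp hx1 j
      rwa [hc₁j₁] at this
    · rw [hRm]; simp only [h1, if_false]
      exact (mem_polydisc K).mp hx0 j
  have hvolRm : (piVolume K (polydisc K Rm)).toReal = ((residueCard (K j₁) : ℝ) ^ b)⁻¹ := by
    rw [piVolume_real_polydisc]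
    rw [Finset.prod_eq_single j₁ (fun j _ hj => by
        rw [hRm]; simp only [hj, if_false]; rw [localVolume_closedBall_one, ENNReal.toReal_one])
      (fun h => absurd (Finset.mem_univ _) h)]
    rw [hRm]; simp only [if_true]
    rw [hy₁norm, localVolume_real_closedBall_zpow (K j₁) hϖ₁, zpow_neg, zpow_natCast]
  have hvolI : (piVolume K (H₀ ∩ H₁)).toReal ≤ ((residueCard (K j₁) : ℝ) ^ b)⁻¹ := by
    rw [← hvolRm]
    exact ENNReal.toReal_mono (piVolume_polydisc_ne_top K _) (measure_mono hIsub)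
  have hqb : ((residueCard (K j₁) : ℝ) ^ b)⁻¹ < 1 :=
    inv_lt_one_of_one_lt₀ (one_lt_pow₀ hq₁ hb.ne')
  have hvolU : 1 < (piVolume K (H₀ ∪ H₁)).toReal := by linarith
  have hvolΞ : 1 < (piVolume K (LogThetaLattice.HXi (hullSets K) (holomorphicHull K) μlog P)).toReal :=
    lt_of_lt_of_le hvolU (ENNReal.toReal_mono hΞfin (measure_mono hUsub))
  -- the region `P` and the conclusion
  refine ⟨P, ⟨A, rfl, ⟨fun j => ?_, fun j => ?_⟩⟩, ?_⟩
  · by_cases hj : j = j₀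
    · subst hj; rw [hAj₀]; exact (isCompact_closedBall _ _).union isCompact_singleton
    · rw [hAj j hj]; exact isCompact_closedBall _ _
  · show 0 < localVolume (K j) (A j)
    exact lt_of_lt_of_le (localVolume_closedBall_pos K j one_pos) (measure_mono (hball j))
  · show Real.log (piVolume K P).toReal <
      Real.log (piVolume K (LogThetaLattice.HXi (hullSets K) (holomorphicHull K) μlog P)).toReal
    rw [hvolP, Real.log_one]
    exact Real.log_pos hvolΞ

/-- **(Ξ3) at general cardinality, equal residue fields** (print's example shape `I = ℚ_p × ℚ_p`, now inside
ANY finite family with two coordinates `j₀ ≠ j₁` of the same residue cardinality): exponents `a = b = 1`, i.e.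
`H₁ = ϖ₀^{-1}𝒪 × ϖ₁𝒪 × Π 𝒪` — PROVED. [cite: Mochizuki2012, IUTchIII Rmk. 3.9.5 (iv) p. 129] -/
theorem exists_region_logVol_lt_logVol_hXi_of_residueCard_eq {j₀ j₁ : J} (hne : j₀ ≠ j₁)
    (hq : residueCard (K j₀) = residueCard (K j₁)) :
    ∃ P ∈ directProductRegions K,
      Real.log (piVolume K P).toReal <
        Real.log (piVolume K (LogThetaLattice.HXi (hullSets K) (holomorphicHull K)
          (fun S => Real.log (piVolume K S).toReal) P)).toReal := by
  obtain ⟨ϖ₀, hϖ₀⟩ := exists_isUniformizer (F := K j₀)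
  obtain ⟨ϖ₁, hϖ₁⟩ := exists_isUniformizer (F := K j₁)
  exact exists_region_logVol_lt_logVol_hXi K hne hϖ₀ hϖ₁ (a := 1) (b := 1) one_pos
    (by rw [pow_one, pow_one, hq])

end Xi3General

end Literature.IUT.LogVolume
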